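import Mathlib
import Literature.NumberTheory.Automorphic.ResGLnCohomology
import Literature.NumberTheory.Automorphic.ResGLnHermitianCone
import Literature.NumberTheory.Automorphic.AdelicStabilizerArithmetic
import HarnessLib

/-!
# Unit determinants on the arithmetic stabiliser of a finite-adelic coset
# (crux `HeckeEigenvalueField`, stmt-Langlands-13632, line `Sketch`, stub
# `stub_abs_norm_det_eq_one_of_smul_eq`)

Namespace `Summit.Langlands.Langlands.Theorems.HeckeEigenvalueField.Res`; theorems only.

If `γ ∈ GL_n(K)` stabilises a coset `c = x K_f(𝔫)` of the level in `GL_n(𝔸_K^∞)`, then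
`x⁻¹ γ_f x ∈ K_f(𝔫) ⊆ GL_n(𝒪̂_K)` (`finitePrincipalCongruenceLevel_le`), so `det γ_f = det (x⁻¹ γ_f x)`
and its inverse lie in `𝒪̂_K`; as `K ∩ 𝒪̂_K = 𝓞_K` (`algebraMap_mem_integralFiniteAdeles_iff`),
`det γ` is a unit of `𝓞_K`, hence `|N_{K/ℚ}(det γ)| = 1`, and, read in `K_∞ = mixedSpace K`,
`mixedEmbedding.norm (det γ_∞) = |N_{K/ℚ}(det γ)| = 1` (Mathlib `mixedEmbedding.norm_eq_norm`).

## References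

* A. Borel, *Introduction aux groupes arithmétiques*, Hermann (1969), §7 [Borel1969].
-/

set_option linter.dupNamespace false -- project-wide: `Summit.Langlands.Langlands` is the mandated namespace

noncomputable section

open scoped MatrixGroups Matrix
open NumberField NumberField.mixedEmbedding IsDedekindDomain Literature.NumberTheory.Automorphic

namespace Summit.Langlands.Langlands.Theorems.HeckeEigenvalueField.Res

/-- The determinant of a square matrix with entries in a subring lies in the subring. [folklore] -/
theorem det_mem_subring_of_forall_mem {R : Type*} [CommRing R] {m : Type*} [Fintype m]
    [DecidableEq m] (S : Subring R) {M : Matrix m m R} (hM : ∀ i j, M i j ∈ S) : M.det ∈ S := by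
  set M' : Matrix m m S := fun i j => ⟨M i j, hM i j⟩
  have hM' : S.subtype.mapMatrix M' = M := by
    ext i j
    rfl
  rw [← hM', ← RingHom.map_det]
  exact (M'.det).2

/-- **`det` of a rational element conjugate into `GL_n(𝒪̂_K)` is an algebraic integer**: if
`x⁻¹ δ_f x ∈ GL_n(𝒪̂_K)` for some `x ∈ GL_n(𝔸_K^∞)`, then `det δ ∈ 𝓞_K`
(`det δ_f = det (x⁻¹ δ_f x) ∈ 𝒪̂_K` and `K ∩ 𝒪̂_K = 𝓞_K`). [folklore] -/
theorem det_mem_range_of_conj_mem_glFiniteIntegralLevel {n : ℕ} {K : Type} [Field K]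
    [NumberField K] (x : BigHeckeGLn.FiniteAdelicGL n K) (δ : GL (Fin n) K)
    (hδ : x⁻¹ * BigHeckeGLn.globalEmbedding n K δ * x ∈ glFiniteIntegralLevel n K) :
    Matrix.det (δ : Matrix (Fin n) (Fin n) K) ∈ (algebraMap (𝓞 K) K).range := by
  have h : Matrix.det ((x⁻¹ * BigHeckeGLn.globalEmbedding n K δ * x : BigHeckeGLn.FiniteAdelicGL n K) :
      Matrix (Fin n) (Fin n) (FiniteAdeleRing (𝓞 K) K)) ∈ integralFiniteAdeles K :=
    det_mem_subring_of_forall_mem _ (mem_glFiniteIntegralLevel_iff.1 hδ).1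
  rw [Units.val_mul, Units.val_mul, Matrix.det_units_conj',
    show ((BigHeckeGLn.globalEmbedding n K δ : BigHeckeGLn.FiniteAdelicGL n K) :
        Matrix (Fin n) (Fin n) (FiniteAdeleRing (𝓞 K) K)) =
      (algebraMap K (FiniteAdeleRing (𝓞 K) K)).mapMatrix (δ : Matrix (Fin n) (Fin n) K) from rfl,
    ← RingHom.map_det] at h
  exact algebraMap_mem_integralFiniteAdeles_iff.1 h

/-- **Stub DET-UNIT — rational elements stabilising a finite-adelic coset of the level have unit
determinant**: if `γ_f • c = c` for a coset `c` of `K_f(𝔫)`, then `det γ ∈ K^× ∩ det(x K_f(𝔫) x⁻¹) ⊆ 𝒪̂^×`,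
so `det γ` is a unit of `𝒪_K` and `|N_{K/ℚ}(det γ)| = 1`; read in `K_∞`:
`mixedEmbedding.norm (det γ_∞) = ±1`. [cite: Borel1969, §7] [folklore] -/
theorem stub_abs_norm_det_eq_one_of_smul_eq (n : ℕ) (K : Type) [Field K] [NumberField K]
    (𝔫 : Ideal (𝓞 K)) (c : BigHeckeGLn.FiniteAdelicGL n K ⧸ ResGLnCohomology.level n K 𝔫)
    (γ : GL (Fin n) K) (hγ : BigHeckeGLn.globalEmbedding n K γ • c = c) :
    |Algebra.norm ℚ (Matrix.det (γ : Matrix (Fin n) (Fin n) K))| = 1 ∧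
      |mixedEmbedding.norm (Matrix.det ((ResGLnCone.toMixedGL n K γ : GL (Fin n) (mixedSpace K)) :
        Matrix (Fin n) (Fin n) (mixedSpace K)))| = 1 := by
  have h1 : |Algebra.norm ℚ (Matrix.det (γ : Matrix (Fin n) (Fin n) K))| = 1 := by
    obtain ⟨x, rfl⟩ := QuotientGroup.mk_surjective c
    rw [MulAction.Quotient.smul_mk, smul_eq_mul] at hγ
    -- `x⁻¹ γ_f x ∈ K_f(𝔫) ⊆ GL_n(𝒪̂_K)`
    have hmem : x⁻¹ * BigHeckeGLn.globalEmbedding n K γ * x ∈ glFiniteIntegralLevel n K := by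
      have h := QuotientGroup.eq.1 hγ.symm
      rw [← mul_assoc] at h
      exact finitePrincipalCongruenceLevel_le n K 𝔫 h
    have hmem' : x⁻¹ * BigHeckeGLn.globalEmbedding n K γ⁻¹ * x ∈ glFiniteIntegralLevel n K := by
      have h := Subgroup.inv_mem _ hmem
      rwa [mul_inv_rev, mul_inv_rev, inv_inv, ← map_inv, ← mul_assoc] at h
    -- `det γ` and `det γ⁻¹` are algebraic integers
    obtain ⟨r, hr⟩ := det_mem_range_of_conj_mem_glFiniteIntegralLevel x γ hmem
    obtain ⟨s, hs⟩ := det_mem_range_of_conj_mem_glFiniteIntegralLevel x γ⁻¹ hmem'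
    have hrs : r * s = 1 := by
      apply IsFractionRing.injective (𝓞 K) K
      rw [map_mul, map_one, hr, hs, ← Matrix.det_mul, ← Units.val_mul, mul_inv_cancel,
        Units.val_one, Matrix.det_one]
    have habs : |Algebra.norm ℤ r| = 1 :=
      Int.isUnit_iff_abs_eq.1 ((IsUnit.of_mul_eq_one s hrs).map (Algebra.norm ℤ))
    rw [← hr, ← RingOfIntegers.coe_eq_algebraMap, ← Algebra.coe_norm_int, ← Int.cast_abs, habs,
      Int.cast_one]
  refine ⟨h1, ?_⟩
  rw [ResGLnCone.coe_toMixedGL, ← RingHom.mapMatrix_apply, ← RingHom.map_det,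
    mixedEmbedding.norm_eq_norm, h1, Rat.cast_one, abs_one]

end Summit.Langlands.Langlands.Theorems.HeckeEigenvalueField.Res

end
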